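import Summits.Ventures.HodgeRepro.KubotaLit2
import Summits.Ventures.HodgeRepro.LitRankChar

/-!
# Every CM type of a cyclic Galois CM field of `2`-power degree is non-degenerate

Blind re-derivation cell `pub-hodge-repro`, seat `p1` (gen 6).  Built on typer-2's Kubota character
formula (`KubotaChar.lean`: `cmRank Φ = 1 + #{ψ odd : ∑_Φ ψ ≠ 0}`, transported to `G →* ℂˣ` in
`KubotaLit2.lean`) and lit-2's character count (`LitRankChar.lean`: half of the characters are odd).

**Theorem** (`isNondegenerate_of_cyclic_two_pow`): if `G` is cyclic of order `2^(n+1)` with complex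
conjugation `c`, every CM type `Φ` of `(G, c)` is non-degenerate: `cmRank Φ = |Φ| + 1` (the Mumford–Tate
group of `A_Φ` has the maximal dimension `dim A_Φ + 1`, [Gordon] §9.1 as typed in `CMRank.lean`).

Proof.  Let `g` generate `G`; then `c = g^{2^n}` (`conj_eq_pow_of_generator`).  For an odd character
`χ` (`χ(c) = -1`) put `ζ = χ(g)`: `ζ^{2^n} = -1`, so `ζ` is a primitive `2^{n+1}`-th root of unity.
Pairing each embedding `g^j` (`j < 2^n`) with its conjugate `g^{j + 2^n} = c g^j`, exactly one of which
lies in `Φ`, the character sum is `∑_{j < 2^n} ε_j ζ^j` with `ε_j = ±1`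
(`charSum_ne_zero_of_cyclic_two_pow`).  Such a signed sum never vanishes
(`sum_sign_mul_pow_ne_zero`): the minimal polynomial of `ζ` over `ℚ` is the cyclotomic polynomial
`X^{2^n} + 1`, of degree `2^n`, while `∑ ε_j X^j` is a non-zero rational polynomial of degree `< 2^n`.
Hence every odd character has a non-vanishing sum, and Kubota's formula gives
`cmRank Φ = 1 + #{odd χ} = 1 + |G|/2 = |Φ| + 1`.

Bearing.  [Gordon] Thm 6.4 / §9.3 (Hazama; `route/SOURCES.md` rows G1 6.4, 9.3, as read by lit): a SIMPLE
abelian variety of non-degenerate CM type has `Hdg(A^k) = Div(A^k)` for every `k`.  A primitive CM type of a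
cyclic `2`-power Galois CM field `F` is non-degenerate by this file; an imprimitive one is induced from a
subfield `F^H`, again cyclic of `2`-power degree, so its simple factor is non-degenerate too (p1's reading
of the reduction; not formalised).  So such varieties carry no exceptional Hodge class in any
codimension — consistent with the census zeros of `C₈` (typer, degree 8) and `C₁₆`
(`proofs/p1-g6/singleclass16.out`).  The cyclic groups of order `2d`, `d` an odd prime, are Yanai's
Lemma (`LitRank.lean`, `Yanai1985_lemma_cyclic_nondegenerate`, proved by lit-2); this file is the
`2`-power companion.
-/

set_option autoImplicit false

open Finset Polynomial

namespace HodgeRepro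

/-! ### A signed sum of powers of a primitive `2^(n+1)`-th root of unity never vanishes -/

/-- For a primitive `2^(n+1)`-th root of unity `ζ ∈ ℂ` and signs `ε j ∈ {1, -1}` (`j < 2^n`),
`∑_{j < 2^n} ε j ζ^j ≠ 0`: the minimal polynomial of `ζ` over `ℚ` is `X^{2^n} + 1`, of degree `2^n`,
and the signed sum is the value at `ζ` of a non-zero rational polynomial of degree `< 2^n`. -/
theorem sum_sign_mul_pow_ne_zero {ζ : ℂ} {n : ℕ} (hζ : IsPrimitiveRoot ζ (2 ^ (n + 1)))
    (ε : ℕ → ℚ) (hε : ∀ j, j < 2 ^ n → ε j = 1 ∨ ε j = -1) :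
    ∑ j ∈ range (2 ^ n), (ε j : ℂ) * ζ ^ j ≠ 0 := by
  intro h0
  have hpos : 0 < 2 ^ n := Nat.two_pow_pos n
  set R : ℚ[X] := ∑ j ∈ range (2 ^ n), C (ε j) * X ^ j with hR
  -- `R ≠ 0`: its constant coefficient is `ε 0 = ±1`
  have hR0 : R ≠ 0 := by
    intro h
    have hc : R.coeff 0 = ε 0 := by
      rw [hR, finsetSum_coeff]
      simp only [coeff_C_mul_X_pow]
      rw [Finset.sum_ite_eq, if_pos (Finset.mem_range.2 hpos)]
    rw [h, coeff_zero] at hc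
    rcases hε 0 hpos with h1 | h1 <;> rw [h1] at hc <;> norm_num at hc
  -- `natDegree R < 2^n`
  have hdeg : R.natDegree ≤ 2 ^ n - 1 := by
    rw [hR]
    apply natDegree_sum_le_of_forall_le
    intro j hj
    exact (natDegree_C_mul_X_pow_le _ _).trans (by have := Finset.mem_range.1 hj; omega)
  -- `ζ` is a root of `R`
  have hroot : aeval ζ R = 0 := by
    rw [hR, map_sum]
    simp only [map_mul, aeval_C, map_pow, aeval_X, eq_ratCast]
    exact h0
  -- the minimal polynomial of `ζ` has degree `2^n`
  have hmin : (minpoly ℚ ζ).natDegree = 2 ^ n := by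
    rw [← cyclotomic_eq_minpoly_rat hζ (by positivity), natDegree_cyclotomic,
      Nat.totient_prime_pow Nat.prime_two (Nat.succ_pos n)]
    norm_num
  have h4 := natDegree_le_natDegree (minpoly.degree_le_of_ne_zero ℚ ζ hR0 hroot)
  rw [hmin] at h4
  omega

/-! ### Cyclic groups of `2`-power order -/

variable {G : Type*} [CommGroup G] [Fintype G] [DecidableEq G]

omit [DecidableEq G] in
/-- In a cyclic group of order `2^(n+1)` generated by `g`, the complex conjugation (the unique central
involution) is `g^{2^n}`. -/
theorem conj_eq_pow_of_generator {c g : G} {n : ℕ} (hc : IsComplexConj c)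
    (hg : ∀ x, x ∈ Subgroup.zpowers g) (hcard : Fintype.card G = 2 ^ (n + 1)) :
    c = g ^ (2 ^ n) := by
  have hord : orderOf g = 2 ^ (n + 1) := by
    rw [← hcard, ← Nat.card_eq_fintype_card]
    exact orderOf_eq_card_of_forall_mem_zpowers hg
  obtain ⟨k, hk⟩ := (Submonoid.mem_powers_iff c g).1
    ((isOfFinOrder_of_finite g).mem_powers_iff_mem_zpowers.2 (hg c))
  have h2k : 2 * 2 ^ n ∣ 2 * k := by
    rw [← pow_succ', ← hord, orderOf_dvd_iff_pow_eq_one, pow_mul', hk, sq, hc.mul_self]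
  obtain ⟨q, hq⟩ := Nat.dvd_of_mul_dvd_mul_left (by norm_num) h2k
  rcases Nat.even_or_odd q with ⟨r, hr⟩ | ⟨r, hr⟩
  · exfalso
    apply hc.ne_one
    rw [← hk, hq, hr, show 2 ^ n * (r + r) = 2 ^ (n + 1) * r by ring, pow_mul, ← hord,
      pow_orderOf_eq_one, one_pow]
  · rw [← hk, hq, hr, show 2 ^ n * (2 * r + 1) = 2 ^ (n + 1) * r + 2 ^ n by ring, pow_add, pow_mul,
      ← hord, pow_orderOf_eq_one, one_pow, one_mul]

/-- **Every odd character has a non-vanishing sum over a CM type** when `G` is cyclic of order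
`2^(n+1)`: with `ζ = χ(g)` a primitive `2^{n+1}`-th root of unity, `∑_{s ∈ Φ} χ(s) = ∑_{j < 2^n} ε_j ζ^j`
with `ε_j = ±1` according to whether `g^j` or `c g^j` lies in `Φ`. -/
theorem charSum_ne_zero_of_cyclic_two_pow [IsCyclic G] {c : G} {Φ : Finset G} {n : ℕ}
    (hc : IsComplexConj c) (hΦ : IsCMType c Φ) (hcard : Fintype.card G = 2 ^ (n + 1))
    (χ : G →* ℂˣ) (hχ : χ c = -1) : (∑ s ∈ Φ, (χ s : ℂ)) ≠ 0 := by
  obtain ⟨g, hg⟩ := IsCyclic.exists_generator (α := G)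
  have hord : orderOf g = 2 ^ (n + 1) := by
    rw [← hcard, ← Nat.card_eq_fintype_card]
    exact orderOf_eq_card_of_forall_mem_zpowers hg
  have hcg : c = g ^ (2 ^ n) := conj_eq_pow_of_generator hc hg hcard
  obtain ⟨ζ, hζ⟩ : ∃ ζ : ℂ, ζ = (χ g : ℂ) := ⟨_, rfl⟩
  -- `ζ` is a primitive `2^(n+1)`-th root of unity
  have hζn : ζ ^ (2 ^ n) = -1 := by
    rw [hζ, ← Units.val_pow_eq_pow_val, ← map_pow, ← hcg, hχ, Units.val_neg, Units.val_one]
  have hζprim : IsPrimitiveRoot ζ (2 ^ (n + 1)) := by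
    have h1 : ζ ^ (2 ^ (n + 1)) = 1 := by rw [pow_succ, pow_mul, hζn]; norm_num
    have h2 : ¬ ζ ^ (2 ^ n) = 1 := by rw [hζn]; norm_num
    have := orderOf_eq_prime_pow (p := 2) h2 h1
    rw [← this]
    exact IsPrimitiveRoot.orderOf ζ
  -- the embeddings are the powers `g^j`, `j < 2^(n+1)`
  have himg : (range (2 ^ (n + 1))).image (fun j : ℕ => g ^ j) = univ := by
    ext x
    simp only [mem_image, mem_range, mem_univ, iff_true]
    obtain ⟨k, hk⟩ := (Submonoid.mem_powers_iff x g).1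
      ((isOfFinOrder_of_finite g).mem_powers_iff_mem_zpowers.2 (hg x))
    exact ⟨k % 2 ^ (n + 1), Nat.mod_lt _ (by positivity), by rw [← hk, ← hord, pow_mod_orderOf]⟩
  have hinj : Set.InjOn (fun j : ℕ => g ^ j) (range (2 ^ (n + 1))) := by
    intro a ha b hb hab
    simp only [coe_range, Set.mem_Iio] at ha hb
    have := pow_inj_mod.1 hab
    rwa [hord, Nat.mod_eq_of_lt ha, Nat.mod_eq_of_lt hb] at this
  -- the sum over `Φ` as a signed sum over `j < 2^n`
  have hsum : (∑ s ∈ Φ, (χ s : ℂ)) =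
      ∑ j ∈ range (2 ^ n), ((if g ^ j ∈ Φ then (1 : ℚ) else -1 : ℚ) : ℂ) * ζ ^ j := by
    calc (∑ s ∈ Φ, (χ s : ℂ)) = ∑ s ∈ univ, (if s ∈ Φ then (χ s : ℂ) else 0) := by
          rw [← Finset.sum_filter, Finset.filter_mem_eq_inter, Finset.univ_inter]
      _ = ∑ j ∈ range (2 ^ (n + 1)), (if g ^ j ∈ Φ then (χ (g ^ j) : ℂ) else 0) := by
          rw [← himg, Finset.sum_image hinj]
      _ = ∑ j ∈ range (2 ^ n), ((if g ^ j ∈ Φ then (χ (g ^ j) : ℂ) else 0) +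
            (if g ^ (2 ^ n + j) ∈ Φ then (χ (g ^ (2 ^ n + j)) : ℂ) else 0)) := by
          rw [show 2 ^ (n + 1) = 2 ^ n + 2 ^ n by ring, Finset.sum_range_add,
            ← Finset.sum_add_distrib]
      _ = _ := by
          refine Finset.sum_congr rfl fun j _ => ?_
          have e1 : ((χ (g ^ j) : ℂˣ) : ℂ) = ζ ^ j := by
            rw [map_pow, Units.val_pow_eq_pow_val, hζ]
          have e2 : g ^ (2 ^ n + j) = c * g ^ j := by rw [pow_add, hcg]
          have e3 : ((χ (c * g ^ j) : ℂˣ) : ℂ) = -ζ ^ j := by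
            rw [map_mul, hχ, Units.val_mul, Units.val_neg, Units.val_one, e1, neg_one_mul]
          rw [e2]
          by_cases h : g ^ j ∈ Φ
          · rw [if_pos h, if_neg ((hΦ.conj_mem_iff _).not.2 (not_not.2 h)), if_pos h, e1, add_zero,
              Rat.cast_one, one_mul]
          · rw [if_neg h, if_pos ((hΦ.conj_mem_iff _).2 h), if_neg h, e3, zero_add, Rat.cast_neg,
              Rat.cast_one, neg_one_mul]
  rw [hsum]
  exact sum_sign_mul_pow_ne_zero hζprim _ (fun j _ => by by_cases h : g ^ j ∈ Φ <;> simp [h])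

/-- **Every CM type of a cyclic Galois CM field of `2`-power degree is non-degenerate**:
`cmRank Φ = |Φ| + 1` (Kubota's character formula, every odd character contributing). -/
theorem isNondegenerate_of_cyclic_two_pow [IsCyclic G] {c : G} {Φ : Finset G} {n : ℕ}
    (hc : IsComplexConj c) (hΦ : IsCMType c Φ) (hcard : Fintype.card G = 2 ^ (n + 1)) :
    IsNondegenerate Φ := by
  unfold IsNondegenerate
  rw [Hecke.cmRank_eq_one_add_card_odd hc hΦ, ← Hecke.natCard_homUnits_eq]
  have hall : Nat.card {χ : G →* ℂˣ // χ c = -1 ∧ (∑ s ∈ Φ, (χ s : ℂ)) ≠ 0} =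
      Nat.card {χ : G →* ℂˣ // χ c = -1} :=
    Nat.card_congr (Equiv.subtypeEquivRight fun χ =>
      ⟨fun h => h.1, fun h => ⟨h, charSum_ne_zero_of_cyclic_two_pow hc hΦ hcard χ h⟩⟩)
  have h2 := Lit2.two_mul_card_odd_char (G := G) hc.ne_one hc.mul_self
  rw [Nat.card_eq_fintype_card (α := G), ← hΦ.two_mul_card hc] at h2
  rw [hall]
  omega

end HodgeRepro
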